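import Mathlib
import Summits.Ventures.HodgeRepro2.Hypothesis
import Summits.Ventures.HodgeRepro2.BallActionU21
import Summits.Ventures.HodgeRepro2.Neat
import Summits.Ventures.HodgeRepro2.Level
import Summits.Ventures.HodgeRepro2.LevelNeat
import Summits.Ventures.HodgeRepro2.DefiniteUnitaryBounded
import Summits.Ventures.HodgeRepro2.IntegralUnitaryDiscrete
import Summits.Ventures.HodgeRepro2.LevelDiscrete
import Summits.Ventures.HodgeRepro2.BallStabilizerBounded

/-!
# Finite stabilisers and free action: the discrete group acts properly on the ball

`LevelDiscrete.lean` proved that the frame image of any `Γ ⊆ Γ_N` is a discrete subset of `U(2,1)`,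
and `BallStabilizerBounded.lean` that the stabiliser in `U(2,1)` of a point of the ball has bounded
entries.  Together (Shimura, J. Math. Soc. Japan 31 (1979), §4; Dimitrov–Ramakrishnan, Doc. Math. 20
(2015), §1–§2: `Γ\𝔹²` is a compact complex surface for neat `Γ`):

* `finite_stabilizer_of_subset_shimuraLevel` — **the stabiliser in `Γ ⊆ Γ_N` of every point of the
  ball is finite** (any lattice `𝔪`, `H` definite off `τ₁`, any frame);
* `eq_one_of_ballAction_eq_self_of_isTorsionFreeSet_of_subset` — for a torsion-free subgroup
  `S ⊆ Γ_N` (the `IsTorsionFreeSet` shape of `Neat.lean`) an element fixing a point of the ball is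
  `1` (its powers lie in the finite stabiliser, so it has finite order);
* `eq_one_of_ballAction_eq_self_of_isTorsionFreeSet` — the same for the finite-index subgroups
  `Γ ≤ Γ_1` quantified in `NonVanishingInput`;
* `eq_one_of_ballAction_eq_self_of_mem_shimuraLevel` — **Shimura's `Γ_N` acts freely on the ball for
  `N > 2`** (`isTorsionFreeSet_shimuraLevel`, `LevelNeat.lean` p394366: `Γ_N` is neat, DR15 Lemma 1.4).
-/

open Matrix
open scoped ComplexOrder

namespace Summit.Ventures.HodgeRepro2.ShimuraData

section CMField

variable {K : Type*} [Field K] [NumberField K] [NumberField.IsCMField K]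

/-- **Finite stabilisers.**  For `Γ ⊆ Γ_N` (any lattice `𝔪`, `H` definite off `τ₁`, a frame `Q`)
and any `z ∈ 𝔹²`, the elements of `Γ` fixing `z` form a finite set. -/
theorem finite_stabilizer_of_subset_shimuraLevel {τ₁ : K →+* ℂ} {H : Matrix (Fin 3) (Fin 3) K}
    (hH : IsHermitianForm K H)
    (hdef : ∀ τ : K →+* ℂ, NumberField.InfinitePlace.mk τ ≠ NumberField.InfinitePlace.mk τ₁ →
      IsDefiniteAt K τ H)
    {Q : Matrix (Fin 3) (Fin 3) ℂ} (hQ : IsFrame K τ₁ H Q) {𝔪 : Submodule ℤ (Fin 3 → K)}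
    (h𝔪 : IsLattice K 𝔪) {N : ℕ} {Γ : Set (GL (Fin 3) K)} (hΓ : Γ ⊆ shimuraLevel K H 𝔪 N)
    {z : Fin 2 → ℂ} (hz : z ∈ ball₂) :
    {γ : GL (Fin 3) K | γ ∈ Γ ∧ ballAction (realEmbedding K τ₁ Q γ) z = z}.Finite := by
  have hw : hermJ21 (homog z) < 0 := (mem_ball₂_iff_hermJ21_homog_neg z).mp hz
  obtain ⟨C, hC⟩ := exists_entry_bound_of_mulVec_eq_smul hw
  refine (finite_of_subset_shimuraLevel hH τ₁ hdef h𝔪 hΓ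
    ((3 * 3 : ℝ) * (entrySum Q⁻¹ * ((3 * 3 : ℝ) * C)) * entrySum Q)).subset ?_
  rintro γ ⟨hγ, hfix⟩
  have hU : γ ∈ unitaryGroup K H := (hΓ hγ).1.1
  have hα : IsInU21 (realEmbedding K τ₁ Q γ) := hQ.isInU21_realEmbedding hU
  exact ⟨hγ, norm_map_apply_le_of_realEmbedding_le hQ γ
    (hC _ hα (hα.exists_mulVec_homog_eq_smul_of_ballAction_eq hz hfix))⟩

/-- **Free action of a torsion-free subgroup.**  If `S ⊆ Γ_N` is a torsion-free subgroup
(`IsTorsionFreeSet`), an element of `S` fixing a point of the ball is `1`: its powers lie in the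
finite stabiliser, so it has finite order. -/
theorem eq_one_of_ballAction_eq_self_of_isTorsionFreeSet_of_subset {τ₁ : K →+* ℂ}
    {H : Matrix (Fin 3) (Fin 3) K} (hH : IsHermitianForm K H)
    (hdef : ∀ τ : K →+* ℂ, NumberField.InfinitePlace.mk τ ≠ NumberField.InfinitePlace.mk τ₁ →
      IsDefiniteAt K τ H)
    {Q : Matrix (Fin 3) (Fin 3) ℂ} (hQ : IsFrame K τ₁ H Q) {𝔪 : Submodule ℤ (Fin 3 → K)}
    (h𝔪 : IsLattice K 𝔪) {N : ℕ} {S : Subgroup (GL (Fin 3) K)}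
    (hS : (S : Set (GL (Fin 3) K)) ⊆ shimuraLevel K H 𝔪 N)
    (htf : IsTorsionFreeSet K (S : Set (GL (Fin 3) K)))
    {γ : GL (Fin 3) K} (hγ : γ ∈ S) {z : Fin 2 → ℂ} (hz : z ∈ ball₂)
    (hfix : ballAction (realEmbedding K τ₁ Q γ) z = z) : γ = 1 := by
  have hfin := finite_stabilizer_of_subset_shimuraLevel hH hdef hQ h𝔪 hS hz
  have hα : IsInU21 (realEmbedding K τ₁ Q γ) :=
    hQ.isInU21_realEmbedding (hS hγ).1.1
  -- all powers of `γ` lie in the stabiliser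
  have hpow : ∀ n : ℕ, γ ^ n ∈ (S : Set (GL (Fin 3) K)) ∧
      ballAction (realEmbedding K τ₁ Q (γ ^ n)) z = z := by
    intro n
    induction n with
    | zero =>
      refine ⟨?_, ?_⟩
      · rw [pow_zero, SetLike.mem_coe]; exact S.one_mem
      · rw [pow_zero, hQ.realEmbedding_one, ballAction_one]
    | succ n ih =>
      refine ⟨?_, ?_⟩
      · rw [pow_succ, SetLike.mem_coe]
        exact S.mul_mem (SetLike.mem_coe.mp ih.1) hγ
      · rw [pow_succ, hQ.realEmbedding_mul, hα.ballAction_mul hz, hfix, ih.2]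
  obtain ⟨a, b, hab, heq⟩ := Set.Finite.exists_lt_map_eq_of_forall_mem
    (t := {γ' : GL (Fin 3) K | γ' ∈ (S : Set (GL (Fin 3) K)) ∧
      ballAction (realEmbedding K τ₁ Q γ') z = z})
    (f := fun n : ℕ => γ ^ n) (fun n => hpow n) hfin
  have hone : γ ^ (b - a) = 1 := by
    have h1 : γ ^ (b - a) * γ ^ a = γ ^ b := pow_sub_mul_pow γ hab.le
    rw [← heq] at h1
    exact mul_right_cancel (h1.trans (one_mul _).symm)
  exact htf γ hγ (b - a) (Nat.sub_pos_of_lt hab) hone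

/-- **Free action of a torsion-free finite-index subgroup of `Γ_1`** — the groups quantified in
`NonVanishingInput` (`IsFiniteIndexSubgroupOf`), when torsion-free. -/
theorem eq_one_of_ballAction_eq_self_of_isTorsionFreeSet {τ₁ : K →+* ℂ}
    {H : Matrix (Fin 3) (Fin 3) K} (hH : IsHermitianForm K H)
    (hdef : ∀ τ : K →+* ℂ, NumberField.InfinitePlace.mk τ ≠ NumberField.InfinitePlace.mk τ₁ →
      IsDefiniteAt K τ H)
    {Q : Matrix (Fin 3) (Fin 3) ℂ} (hQ : IsFrame K τ₁ H Q) {𝔪 : Submodule ℤ (Fin 3 → K)}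
    (h𝔪 : IsLattice K 𝔪) {Γ : Set (GL (Fin 3) K)}
    (hΓ : IsFiniteIndexSubgroupOf K Γ (shimuraLevel K H 𝔪 1)) (htf : IsTorsionFreeSet K Γ)
    {γ : GL (Fin 3) K} (hγ : γ ∈ Γ) {z : Fin 2 → ℂ} (hz : z ∈ ball₂)
    (hfix : ballAction (realEmbedding K τ₁ Q γ) z = z) : γ = 1 := by
  obtain ⟨S, T, rfl, hT, hST, -⟩ := hΓ
  have hS : (S : Set (GL (Fin 3) K)) ⊆ shimuraLevel K H 𝔪 1 := by
    rw [← hT]; exact SetLike.coe_subset_coe.mpr hST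
  exact eq_one_of_ballAction_eq_self_of_isTorsionFreeSet_of_subset hH hdef hQ h𝔪 hS htf hγ hz hfix

/-- **Shimura's `Γ_N` acts freely on the ball for `N > 2`** (`Γ_N` is torsion-free by
`isTorsionFreeSet_shimuraLevel`, the kernel form of DR15 Lemma 1.4). -/
theorem eq_one_of_ballAction_eq_self_of_mem_shimuraLevel {τ₁ : K →+* ℂ}
    {H : Matrix (Fin 3) (Fin 3) K} (hH : IsHermitianForm K H)
    (hdef : ∀ τ : K →+* ℂ, NumberField.InfinitePlace.mk τ ≠ NumberField.InfinitePlace.mk τ₁ →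
      IsDefiniteAt K τ H)
    {Q : Matrix (Fin 3) (Fin 3) ℂ} (hQ : IsFrame K τ₁ H Q) {𝔪 : Submodule ℤ (Fin 3 → K)}
    (h𝔪 : IsLattice K 𝔪) {N : ℕ} (hN : 2 < N) {γ : GL (Fin 3) K}
    (hγ : γ ∈ shimuraLevel K H 𝔪 N) {z : Fin 2 → ℂ} (hz : z ∈ ball₂)
    (hfix : ballAction (realEmbedding K τ₁ Q γ) z = z) : γ = 1 := by
  have hS : ((shimuraLevelSubgroup K H 𝔪 N : Subgroup (GL (Fin 3) K)) : Set (GL (Fin 3) K)) ⊆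
      shimuraLevel K H 𝔪 N := by
    rw [coe_shimuraLevelSubgroup]
  have htf : IsTorsionFreeSet K
      ((shimuraLevelSubgroup K H 𝔪 N : Subgroup (GL (Fin 3) K)) : Set (GL (Fin 3) K)) := by
    rw [coe_shimuraLevelSubgroup]
    exact isTorsionFreeSet_shimuraLevel τ₁ H h𝔪 hN
  have hγ' : γ ∈ shimuraLevelSubgroup K H 𝔪 N := by
    rw [← SetLike.mem_coe, coe_shimuraLevelSubgroup]; exact hγ
  exact eq_one_of_ballAction_eq_self_of_isTorsionFreeSet_of_subset hH hdef hQ h𝔪 hS htf hγ' hz hfix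

end CMField

end Summit.Ventures.HodgeRepro2.ShimuraData
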